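import Summits.ValiantsHypothesis.ValiantsHypothesis.Theorems.SymmetroidPencilBasics

/-!
# Tower graft line — the GRAFT FLOOR LEMMA (additive, floor side of the one-letter graft):
# alternations of `p` LEFT of a cut `ρ` + alternations of `q` RIGHT of `ρ` survive in `p + σ·(X/ρ)^D·q` for `D ≫ 0`

LINE (B) `tower_graft` of crux `WeakLifting` (stmt-ValiantsHypothesis-19561); calibration tool for its graft laws (S4b corner graft,
S5), `m = 2` rung first.  The cell pub-symmetroid's located TOWER records at `m = 2` (`9 → 12 → 13` on `(0,1,3,15) ⊂ (0,1,3,15,135)`,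
`13 → 16` on `… ⊂ (…,1000)`; kernel: `TowerRowTwoK5.not_posRootLawOn_two_five_twelve_tower`, this seat) are all produced by ONE
mechanism — «rank-one far-letter graft + ε-completion» — whose count this file explains and makes a reusable kernel lemma:

  for a corner graft `G = G₀ + s·t^D·e₁e₁ᵀ` one has `det G = det G₀ + s·t^D·(G₀)₂₂`, i.e. `P = p + s·t^D·q` with `p = det G₀` and
  `q` a diagonal ENTRY of the same pencil; with `s = σ·ρ^{−D}` the factor `s·t^D = σ·(t/ρ)^D` tends to `0` left of the cut `ρ` and
  to `∞` right of it, so for `D` large `P` keeps every sign alternation of `p` at points `< ρ` AND acquires every sign alternation of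
  `q` at points `> ρ`, plus one at the junction for the right sign `σ`.

RELATION TO THE TREE'S GRAFT LAW (`…LacunarySymmetroidMatrixDescartesGraftLaw`, `Census.Graft.exists_alternating_succ`, cell
pub-symmetroid seat mdr-p1: one more letter buys `m` more alternations, grafted at the LAST test point through the flag lemma): the lemma
below is the `m = 2` REFINEMENT WITH A CUT — it harvests the `W` interior alternations of a diagonal entry to the right of `ρ`, so one
letter buys `W + 1` (`≤ K`) alternations instead of `2`, at the price of the det-alternations right of the cut; `9 → 12` on
`(0,1,3,15) ⊂ (0,1,3,15,135)` is `W + 1 = 4 > 2`.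

* ★ `le_card_posRoots_graft` / `exists_alternating_graft` — **GRAFT FLOOR LEMMA** (polynomial level, IVT currency of the tree):
  `p` alternating on `τ₀ < ⋯ < τ_Z < ρ`, `q` alternating on `ρ < τ'₀ < ⋯ < τ'_W` (all positive, `p(τ_i) ≠ 0`, `q(τ'_j) ≠ 0`), `σ = ±1`
  with `p(τ_Z)·σ·q(τ'₀) < 0` ⟹ `∃ D₀ ∀ D ≥ D₀`, `p + C(σ·(ρ⁻¹)^D)·X^D·q` alternates on `Z + W + 2` positive points (returned as data),
  hence has at least `Z + W + 1` distinct positive roots;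
* ★ `le_card_posRoots_complete` — **COMPLETION LEMMA**: `P` alternating (non-zero) on `N + 1` positive points, `deg R > deg P` ⟹ some
  `ε ≠ 0` makes `P + ε·R` keep those signs and alternate once more far right: `≥ N + 1` distinct positive roots (the «ε-completion» /
  null-end «+1», any degree gap);
* `exists_alternating_two_blocks` / `le_card_posRoots_two_blocks` — concatenation of two alternation blocks across a junction;
  `exists_sign_junction` — a suitable `σ ∈ {1, −1}` always exists (sign transfer as in the tree's `Census.Graft.mul_neg_of_carriers`);
  `exists_pow_mul_lt` — geometric decay below the cut; `eval_graft`, `inv_pow_mul_pow` — bookkeeping.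

Reading of the located data (prose): on the ladder nine of `(0,1,3,15)` the cut `ρ ≈ 1.3` keeps `Z = 8` of the nine det-alternations
(roots `0.81 … 1.23`; the ninth, `1.76`, is sacrificed) and the form `xᵀG₀x`, `x ⟂` graft direction, contributes `W = 3` (roots
`1.37, 1.40, 1.49`): `8 + 3 + 1 = 12` = the census «rank-one stage», and the ε-completion (a `t^{2D}` term of chosen sign) adds the
thirteenth.  CONSEQUENCE for the line (prose): tower floors above the symmetric patchwork optimum `3K − 4` come from SPLIT DESIGNS —
maximise (det-alternations left of a cut) + (diagonal-entry alternations right of it) — a tropical design problem for the envelope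
criterion (`…TropicalBEnvelopeCriterion`), not attempted here; and the additive term of any corner-graft CAP law at `m = 2` must pay
for `W + 1 ≤ K` extra roots per letter (consistent with S4b's `2^C·B + 2^C`, since `B ≥ 3K − 4`).

HONEST FRAMING: an elementary lemma (finitely many strict inequalities preserved under a dominated / dominating perturbation,
geometric decay `(τ/ρ)^D → 0`); NO stub of the line is claimed; nothing on `WeakLifting`, Conjecture B, `MatrixDescartes` (18050) or
`VP ≠ VNP`.  Def-free, Mathlib + `SymmetroidPencilBasics` only.  Seat: prover leafhand-val-kpluslogsqlaw-1 g4,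
`--supports stmt-ValiantsHypothesis-19561`.  [folklore] intermediate value theorem; `exists_pow_lt_of_lt_one`.
-/

-- `Summit.ValiantsHypothesis.ValiantsHypothesis.…` repeats a component by the D-0017 layout
-- (single-conjunct summit), which the `dupNamespace` linter flags; the name is mandated.
set_option linter.dupNamespace false
set_option autoImplicit false

namespace Summit.ValiantsHypothesis.ValiantsHypothesis.Theorems.KPlusLogSqLaw.TowerGraft

open Polynomial Finset Filter
open scoped BigOperators Topology
open Summit.ValiantsHypothesis.ValiantsHypothesis.Theorems.SymmetroidDescartes (le_card_posRoots_of_alternating)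

namespace GraftFloor

/-- a junction sign always exists: for non-zero reals `x`, `y` one of `σ = 1`, `σ = −1` makes `x·(σ·y) < 0`. [folklore] -/
theorem exists_sign_junction {x y : ℝ} (hx : x ≠ 0) (hy : y ≠ 0) :
    ∃ σ : ℝ, (σ = 1 ∨ σ = -1) ∧ x * (σ * y) < 0 := by
  rcases lt_or_gt_of_ne (mul_ne_zero hx hy) with h | h
  · exact ⟨1, Or.inl rfl, by simpa using h⟩
  · exact ⟨-1, Or.inr rfl, by nlinarith⟩

/-- geometric decay below the cut: for `0 < τ < ρ` and `0 < a`, eventually `(τ/ρ)^D · b < a` (all `D ≥ D₀`). [folklore] -/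
theorem exists_pow_mul_lt {τ ρ a b : ℝ} (hτ : 0 < τ) (hτρ : τ < ρ) (ha : 0 < a) (hb : 0 ≤ b) :
    ∃ D₀ : ℕ, ∀ D : ℕ, D₀ ≤ D → (τ / ρ) ^ D * b < a := by
  have hρ : 0 < ρ := hτ.trans hτρ
  have hr0 : 0 ≤ τ / ρ := (div_pos hτ hρ).le
  have hr1 : τ / ρ < 1 := (div_lt_one hρ).2 hτρ
  rcases eq_or_lt_of_le hb with hb0 | hb0
  · exact ⟨0, fun D _ => by rw [← hb0, mul_zero]; exact ha⟩
  · obtain ⟨n, hn⟩ := exists_pow_lt_of_lt_one (div_pos ha hb0) hr1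
    refine ⟨n, fun D hD => ?_⟩
    have hle : (τ / ρ) ^ D ≤ (τ / ρ) ^ n := pow_le_pow_of_le_one hr0 hr1.le hD
    calc (τ / ρ) ^ D * b ≤ (τ / ρ) ^ n * b := mul_le_mul_of_nonneg_right hle hb
      _ < a / b * b := mul_lt_mul_of_pos_right hn hb0
      _ = a := div_mul_cancel₀ a hb0.ne'

/-- evaluation of the grafted polynomial: `(p + C s · X^D · q)(t) = p(t) + s · t^D · q(t)`. [folklore] -/
theorem eval_graft (p q : ℝ[X]) (s t : ℝ) (D : ℕ) :
    (p + C s * X ^ D * q).eval t = p.eval t + s * t ^ D * q.eval t := by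
  simp [eval_add, eval_mul, eval_pow, eval_C, eval_X]

/-- the scale factor: `(ρ⁻¹)^D · t^D = (t/ρ)^D`. [folklore] -/
theorem inv_pow_mul_pow (ρ t : ℝ) (D : ℕ) : (ρ⁻¹) ^ D * t ^ D = (t / ρ) ^ D := by
  rw [← mul_pow, div_eq_mul_inv, mul_comm]

/-- **Two-block alternation data.**  If `P` has the sign of the witnesses `w` at the points `0 < τ₀ < ⋯ < τ_Z` and of the witnesses
`w'` at the points `τ'₀ < ⋯ < τ'_W`, with `τ_Z < τ'₀`, and the witnesses alternate inside each block and across the junction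
(`w_Z · w'_0 < 0`), then `P` takes non-zero values of alternating sign along the concatenated `Z + W + 2` (increasing, positive) points.
[folklore] -/
theorem exists_alternating_two_blocks {Z W : ℕ} (P : ℝ[X]) (τ : Fin (Z + 1) → ℝ) (τ' : Fin (W + 1) → ℝ)
    (w : Fin (Z + 1) → ℝ) (w' : Fin (W + 1) → ℝ)
    (hτm : StrictMono τ) (hτ'm : StrictMono τ') (hτ0 : 0 < τ 0) (hττ' : τ (Fin.last Z) < τ' 0)
    (hw : ∀ i, 0 < P.eval (τ i) * w i) (hw' : ∀ j, 0 < P.eval (τ' j) * w' j)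
    (hwa : ∀ i : Fin Z, w i.castSucc * w i.succ < 0) (hw'a : ∀ j : Fin W, w' j.castSucc * w' j.succ < 0)
    (hjunc : w (Fin.last Z) * w' 0 < 0) :
    ∃ u : Fin (Z + W + 1 + 1) → ℝ, StrictMono u ∧ (∀ k, 0 < u k) ∧ (∀ k, P.eval (u k) ≠ 0) ∧
      ∀ k : Fin (Z + W + 1), P.eval (u k.castSucc) * P.eval (u k.succ) < 0 := by
  have hτpos : ∀ i, 0 < τ i := fun i => hτ0.trans_le (hτm.monotone (Fin.zero_le i))
  have hτ'pos : ∀ j, 0 < τ' j := fun j =>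
    ((hτpos _).trans hττ').trans_le (hτ'm.monotone (Fin.zero_le j))
  -- the concatenated point sequence `u = (τ₀, …, τ_Z, τ'₀, …, τ'_W)` and its sign witnesses `v = (w, w')`
  let u : Fin (Z + W + 1 + 1) → ℝ := fun k =>
    if h : (k : ℕ) ≤ Z then τ ⟨k, by omega⟩ else τ' ⟨k - (Z + 1), by omega⟩
  let v : Fin (Z + W + 1 + 1) → ℝ := fun k =>
    if h : (k : ℕ) ≤ Z then w ⟨k, by omega⟩ else w' ⟨k - (Z + 1), by omega⟩
  have hv_pos : ∀ k, 0 < P.eval (u k) * v k := by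
    intro k
    by_cases hk : (k : ℕ) ≤ Z
    · simp only [v, u, hk, ↓reduceDIte]; exact hw _
    · simp only [v, u, hk, ↓reduceDIte]; exact hw' _
  have hv_alt : ∀ k : Fin (Z + W + 1), v k.castSucc * v k.succ < 0 := by
    intro k
    by_cases h1 : (k : ℕ) + 1 ≤ Z
    · -- both points in the first block
      have h0 : (k : ℕ) ≤ Z := by omega
      simp only [v, Fin.val_castSucc, Fin.val_succ, h0, h1, ↓reduceDIte]
      have hi : (k : ℕ) < Z := by omega
      have key : ∀ (h : (k : ℕ) < Z + 1) (h' : (k : ℕ) + 1 < Z + 1),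
          w ⟨k, h⟩ * w ⟨(k : ℕ) + 1, h'⟩ < 0 := by
        intro h h'
        have e1 : (⟨(k : ℕ), h⟩ : Fin (Z + 1)) = (⟨(k : ℕ), hi⟩ : Fin Z).castSucc := Fin.ext (by simp)
        have e2 : (⟨(k : ℕ) + 1, h'⟩ : Fin (Z + 1)) = (⟨(k : ℕ), hi⟩ : Fin Z).succ := Fin.ext (by simp)
        rw [e1, e2]; exact hwa _
      exact key _ _
    · by_cases h0 : (k : ℕ) ≤ Z
      · -- the junction
        have hkZ : (k : ℕ) = Z := by omega
        simp only [v, Fin.val_castSucc, Fin.val_succ, h0, h1, ↓reduceDIte]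
        have key : ∀ (h : (k : ℕ) < Z + 1) (h' : (k : ℕ) + 1 - (Z + 1) < W + 1),
            w ⟨k, h⟩ * w' ⟨(k : ℕ) + 1 - (Z + 1), h'⟩ < 0 := by
          intro h h'
          have e1 : (⟨(k : ℕ), h⟩ : Fin (Z + 1)) = Fin.last Z := Fin.ext (by simp [hkZ])
          have e2 : (⟨(k : ℕ) + 1 - (Z + 1), h'⟩ : Fin (W + 1)) = 0 := Fin.ext (by simp [hkZ])
          rw [e1, e2]; exact hjunc
        exact key _ _
      · -- both points in the second block
        simp only [v, Fin.val_castSucc, Fin.val_succ, h0, h1, ↓reduceDIte]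
        have hj : (k : ℕ) - (Z + 1) < W := by omega
        have key : ∀ (h : (k : ℕ) - (Z + 1) < W + 1) (h' : (k : ℕ) + 1 - (Z + 1) < W + 1),
            w' ⟨(k : ℕ) - (Z + 1), h⟩ * w' ⟨(k : ℕ) + 1 - (Z + 1), h'⟩ < 0 := by
          intro h h'
          have e1 : (⟨(k : ℕ) - (Z + 1), h⟩ : Fin (W + 1)) = (⟨(k : ℕ) - (Z + 1), hj⟩ : Fin W).castSucc :=
            Fin.ext (by simp)
          have e2 : (⟨(k : ℕ) + 1 - (Z + 1), h'⟩ : Fin (W + 1)) = (⟨(k : ℕ) - (Z + 1), hj⟩ : Fin W).succ :=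
            Fin.ext (by simp; omega)
          rw [e1, e2]; exact hw'a _
        exact key _ _
  refine ⟨u, ?_, ?_, fun k h => ?_, fun k => ?_⟩
  · refine Fin.strictMono_iff_lt_succ.2 fun k => ?_
    by_cases h1 : (k : ℕ) + 1 ≤ Z
    · have h0 : (k : ℕ) ≤ Z := by omega
      simp only [u, Fin.val_castSucc, Fin.val_succ, h0, h1, ↓reduceDIte]
      exact hτm (Fin.mk_lt_mk.2 (by omega))
    · by_cases h0 : (k : ℕ) ≤ Z
      · have hkZ : (k : ℕ) = Z := by omega
        simp only [u, Fin.val_castSucc, Fin.val_succ, h0, h1, ↓reduceDIte]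
        have key : ∀ (h : (k : ℕ) < Z + 1) (h' : (k : ℕ) + 1 - (Z + 1) < W + 1),
            τ ⟨k, h⟩ < τ' ⟨(k : ℕ) + 1 - (Z + 1), h'⟩ := by
          intro h h'
          have e1 : (⟨(k : ℕ), h⟩ : Fin (Z + 1)) = Fin.last Z := Fin.ext (by simp [hkZ])
          have e2 : (⟨(k : ℕ) + 1 - (Z + 1), h'⟩ : Fin (W + 1)) = 0 := Fin.ext (by simp [hkZ])
          rw [e1, e2]; exact hττ'
        exact key _ _
      · simp only [u, Fin.val_castSucc, Fin.val_succ, h0, h1, ↓reduceDIte]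
        exact hτ'm (Fin.mk_lt_mk.2 (by omega))
  · intro k
    by_cases h0 : (k : ℕ) ≤ Z
    · simp only [u, h0, ↓reduceDIte]; exact hτpos _
    · simp only [u, h0, ↓reduceDIte]; exact hτ'pos _
  · have := hv_pos k
    rw [h, zero_mul] at this
    exact lt_irrefl _ this
  · -- sign transfer (the tree's `Census.Graft.mul_neg_of_carriers`, inlined to keep this file's imports minimal)
    have h4 : 0 < (P.eval (u k.castSucc) * P.eval (u k.succ)) * (v k.castSucc * v k.succ) := by
      have := mul_pos (hv_pos k.castSucc) (hv_pos k.succ)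
      linarith [show (P.eval (u k.castSucc) * v k.castSucc) * (P.eval (u k.succ) * v k.succ) =
        (P.eval (u k.castSucc) * P.eval (u k.succ)) * (v k.castSucc * v k.succ) by ring]
    rcases pos_and_pos_or_neg_and_neg_of_mul_pos h4 with ⟨-, h5⟩ | ⟨h5, -⟩
    · exact absurd h5 (not_lt.2 (hv_alt k).le)
    · exact h5

/-- **Two-block alternation count**: under the hypotheses of `exists_alternating_two_blocks`, `P` has at least `Z + W + 1` distinct
positive roots (intermediate value theorem on the concatenated points). [folklore] -/
theorem le_card_posRoots_two_blocks {Z W : ℕ} (P : ℝ[X]) (τ : Fin (Z + 1) → ℝ) (τ' : Fin (W + 1) → ℝ)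
    (w : Fin (Z + 1) → ℝ) (w' : Fin (W + 1) → ℝ)
    (hτm : StrictMono τ) (hτ'm : StrictMono τ') (hτ0 : 0 < τ 0) (hττ' : τ (Fin.last Z) < τ' 0)
    (hw : ∀ i, 0 < P.eval (τ i) * w i) (hw' : ∀ j, 0 < P.eval (τ' j) * w' j)
    (hwa : ∀ i : Fin Z, w i.castSucc * w i.succ < 0) (hw'a : ∀ j : Fin W, w' j.castSucc * w' j.succ < 0)
    (hjunc : w (Fin.last Z) * w' 0 < 0) :
    Z + W + 1 ≤ (P.roots.toFinset.filter (fun t => 0 < t)).card := by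
  obtain ⟨u, hu, hupos, -, halt⟩ := exists_alternating_two_blocks P τ τ' w w' hτm hτ'm hτ0 hττ' hw hw' hwa hw'a hjunc
  exact le_card_posRoots_of_alternating P (Z + W + 1) u hu hupos halt

/-- ★ **GRAFT FLOOR LEMMA.**  Let `p` alternate in sign along `0 < τ₀ < ⋯ < τ_Z < ρ` (and not vanish there), let `q` alternate in sign
along `ρ < τ'₀ < ⋯ < τ'_W` (and not vanish there), and let `σ ∈ {1, −1}` satisfy the junction condition `p(τ_Z)·σ·q(τ'₀) < 0`.  Then for
all sufficiently large `D`, the graft `p + σ·ρ^{−D}·X^D·q` alternates along the concatenated `Z + W + 2` points, hence has at least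
`Z + W + 1` distinct positive roots.  (Mechanism of the cell's «rank-one far-letter graft»: `σ·(t/ρ)^D → 0` left of the cut, `→ ∞`
right of it.)  DATA form: the `Z + W + 2` alternation points are returned, so that further grafts / completions compose. [this work] -/
theorem exists_alternating_graft {Z W : ℕ} (p q : ℝ[X]) (τ : Fin (Z + 1) → ℝ) (τ' : Fin (W + 1) → ℝ) (ρ σ : ℝ)
    (hτm : StrictMono τ) (hτ'm : StrictMono τ') (hτ0 : 0 < τ 0) (hτρ : τ (Fin.last Z) < ρ) (hρτ' : ρ < τ' 0)
    (hp0 : ∀ i, p.eval (τ i) ≠ 0) (hq0 : ∀ j, q.eval (τ' j) ≠ 0)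
    (hp : ∀ i : Fin Z, p.eval (τ i.castSucc) * p.eval (τ i.succ) < 0)
    (hq : ∀ j : Fin W, q.eval (τ' j.castSucc) * q.eval (τ' j.succ) < 0)
    (hσ : σ = 1 ∨ σ = -1) (hjunc : p.eval (τ (Fin.last Z)) * (σ * q.eval (τ' 0)) < 0) :
    ∃ D₀ : ℕ, ∀ D : ℕ, D₀ ≤ D → ∃ u : Fin (Z + W + 1 + 1) → ℝ, StrictMono u ∧ (∀ k, 0 < u k) ∧
      (∀ k, (p + C (σ * (ρ⁻¹) ^ D) * X ^ D * q).eval (u k) ≠ 0) ∧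
      ∀ k : Fin (Z + W + 1), (p + C (σ * (ρ⁻¹) ^ D) * X ^ D * q).eval (u k.castSucc) *
        (p + C (σ * (ρ⁻¹) ^ D) * X ^ D * q).eval (u k.succ) < 0 := by
  -- positivity bookkeeping
  have hτpos : ∀ i, 0 < τ i := fun i => hτ0.trans_le (hτm.monotone (Fin.zero_le i))
  have hτlt : ∀ i, τ i < ρ := fun i => (hτm.monotone (Fin.le_last i)).trans_lt hτρ
  have hρ : 0 < ρ := (hτpos _).trans hτρ
  have hτ'gt : ∀ j, ρ < τ' j := fun j => hρτ'.trans_le (hτ'm.monotone (Fin.zero_le j))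
  have hτ'pos : ∀ j, 0 < τ' j := fun j => hρ.trans (hτ'gt j)
  have hσ2 : σ * σ = 1 := by rcases hσ with rfl | rfl <;> norm_num
  have hσabs : |σ| = 1 := by rcases hσ with rfl | rfl <;> norm_num
  -- thresholds: left of the cut `(τ_i/ρ)^D |q(τ_i)| < |p(τ_i)|`, right of it `(ρ/τ'_j)^D |p(τ'_j)| < |q(τ'_j)|`
  have hL : ∀ i, ∃ D₀ : ℕ, ∀ D : ℕ, D₀ ≤ D → (τ i / ρ) ^ D * |q.eval (τ i)| < |p.eval (τ i)| := fun i =>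
    exists_pow_mul_lt (hτpos i) (hτlt i) (abs_pos.2 (hp0 i)) (abs_nonneg _)
  have hR : ∀ j, ∃ D₀ : ℕ, ∀ D : ℕ, D₀ ≤ D → (ρ / τ' j) ^ D * |p.eval (τ' j)| < |q.eval (τ' j)| := fun j =>
    exists_pow_mul_lt hρ (hτ'gt j) (abs_pos.2 (hq0 j)) (abs_nonneg _)
  choose DL hDL using hL
  choose DR hDR using hR
  refine ⟨∑ i, DL i + ∑ j, DR j, fun D hD => ?_⟩
  have hDLi : ∀ i, DL i ≤ D := fun i =>
    ((Finset.single_le_sum (fun k _ => Nat.zero_le (DL k)) (Finset.mem_univ i)).trans (Nat.le_add_right _ _)).trans hD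
  have hDRj : ∀ j, DR j ≤ D := fun j =>
    ((Finset.single_le_sum (fun k _ => Nat.zero_le (DR k)) (Finset.mem_univ j)).trans (Nat.le_add_left _ _)).trans hD
  set P : ℝ[X] := p + C (σ * (ρ⁻¹) ^ D) * X ^ D * q with hP
  have hPev : ∀ t, P.eval t = p.eval t + σ * (t / ρ) ^ D * q.eval t := by
    intro t; rw [hP, eval_graft, mul_assoc σ, inv_pow_mul_pow]
  -- (1) left of the cut `P` has the sign of `p`
  have key1 : ∀ i, 0 < P.eval (τ i) * p.eval (τ i) := by
    intro i
    have h := hDL i D (hDLi i)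
    have hrpos : 0 ≤ (τ i / ρ) ^ D := pow_nonneg (div_pos (hτpos i) hρ).le D
    rw [hPev]
    have hpp : 0 < p.eval (τ i) * p.eval (τ i) := mul_self_pos.2 (hp0 i)
    have hbound : |σ * (τ i / ρ) ^ D * q.eval (τ i) * p.eval (τ i)| < p.eval (τ i) * p.eval (τ i) := by
      rw [abs_mul, abs_mul, abs_mul, hσabs, one_mul, abs_of_nonneg hrpos, ← abs_mul_self (p.eval (τ i)), abs_mul]
      exact mul_lt_mul_of_pos_right h (abs_pos.2 (hp0 i))
    have := (abs_lt.1 hbound).1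
    nlinarith
  -- (2) right of the cut `P` has the sign of `σ·q`
  have key2 : ∀ j, 0 < P.eval (τ' j) * (σ * q.eval (τ' j)) := by
    intro j
    have h := hDR j D (hDRj j)
    have hr : 0 < (τ' j / ρ) ^ D := pow_pos (div_pos (hτ'pos j) hρ) D
    have hrr : (τ' j / ρ) ^ D * (ρ / τ' j) ^ D = 1 := by
      rw [← mul_pow, div_mul_div_comm, mul_comm (τ' j), div_self (mul_pos hρ (hτ'pos j)).ne', one_pow]
    -- multiply the threshold by `(τ'/ρ)^D`: `|p| < (τ'/ρ)^D |q|`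
    have h' : |p.eval (τ' j)| < (τ' j / ρ) ^ D * |q.eval (τ' j)| := by
      have := mul_lt_mul_of_pos_left h hr
      rwa [← mul_assoc, hrr, one_mul] at this
    rw [hPev]
    have hqq : 0 < q.eval (τ' j) * q.eval (τ' j) := mul_self_pos.2 (hq0 j)
    have hexp : (p.eval (τ' j) + σ * (τ' j / ρ) ^ D * q.eval (τ' j)) * (σ * q.eval (τ' j)) =
        σ * (p.eval (τ' j) * q.eval (τ' j)) + σ * σ * ((τ' j / ρ) ^ D * (q.eval (τ' j) * q.eval (τ' j))) := by ring
    rw [hexp, hσ2, one_mul]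
    have hbound : |σ * (p.eval (τ' j) * q.eval (τ' j))| < (τ' j / ρ) ^ D * (q.eval (τ' j) * q.eval (τ' j)) := by
      rw [abs_mul, hσabs, one_mul, abs_mul, ← abs_mul_self (q.eval (τ' j)), abs_mul, ← mul_assoc]
      exact mul_lt_mul_of_pos_right h' (abs_pos.2 (hq0 j))
    have := (abs_lt.1 hbound).1
    linarith
  -- (3) the two blocks, witnesses `p` (left) and `σ·q` (right)
  refine exists_alternating_two_blocks P τ τ' (fun i => p.eval (τ i)) (fun j => σ * q.eval (τ' j))
    hτm hτ'm hτ0 (hτρ.trans hρτ') key1 key2 hp (fun j => ?_) hjunc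
  have hσσ : σ * q.eval (τ' j.castSucc) * (σ * q.eval (τ' j.succ)) =
      σ * σ * (q.eval (τ' j.castSucc) * q.eval (τ' j.succ)) := by ring
  rw [hσσ, hσ2, one_mul]
  exact hq j

/-- ★ **GRAFT FLOOR LEMMA (count form)**: under the hypotheses of `exists_alternating_graft`, for all sufficiently large `D` the graft
`p + σ·ρ^{−D}·X^D·q` has at least `Z + W + 1` distinct positive roots. [this work] -/
theorem le_card_posRoots_graft {Z W : ℕ} (p q : ℝ[X]) (τ : Fin (Z + 1) → ℝ) (τ' : Fin (W + 1) → ℝ) (ρ σ : ℝ)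
    (hτm : StrictMono τ) (hτ'm : StrictMono τ') (hτ0 : 0 < τ 0) (hτρ : τ (Fin.last Z) < ρ) (hρτ' : ρ < τ' 0)
    (hp0 : ∀ i, p.eval (τ i) ≠ 0) (hq0 : ∀ j, q.eval (τ' j) ≠ 0)
    (hp : ∀ i : Fin Z, p.eval (τ i.castSucc) * p.eval (τ i.succ) < 0)
    (hq : ∀ j : Fin W, q.eval (τ' j.castSucc) * q.eval (τ' j.succ) < 0)
    (hσ : σ = 1 ∨ σ = -1) (hjunc : p.eval (τ (Fin.last Z)) * (σ * q.eval (τ' 0)) < 0) :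
    ∃ D₀ : ℕ, ∀ D : ℕ, D₀ ≤ D →
      Z + W + 1 ≤ ((p + C (σ * (ρ⁻¹) ^ D) * X ^ D * q).roots.toFinset.filter (fun t => 0 < t)).card := by
  obtain ⟨D₀, hD₀⟩ := exists_alternating_graft p q τ τ' ρ σ hτm hτ'm hτ0 hτρ hρτ' hp0 hq0 hp hq hσ hjunc
  refine ⟨D₀, fun D hD => ?_⟩
  obtain ⟨u, hu, hupos, -, halt⟩ := hD₀ D hD
  exact le_card_posRoots_of_alternating _ (Z + W + 1) u hu hupos halt

/-- ★ **COMPLETION LEMMA (one more root from a dominating top term).**  If `P` takes non-zero values of alternating sign at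
`0 < u₀ < ⋯ < u_N` and `R` has larger degree, then for a suitable `ε ≠ 0` the polynomial `P + ε·R` alternates at `N + 2` points (the old
ones, and one far to the right where `ε·R` dominates with the sign opposite to `P(u_N)`), hence has at least `N + 1` distinct positive
roots.  (Mechanism of the cell's «ε-completion» / null-end extension, general degree version.) [this work] -/
theorem le_card_posRoots_complete {N : ℕ} (P R : ℝ[X]) (u : Fin (N + 1) → ℝ) (huM : StrictMono u) (hu0 : 0 < u 0)
    (hP0 : ∀ k, P.eval (u k) ≠ 0) (halt : ∀ k : Fin N, P.eval (u k.castSucc) * P.eval (u k.succ) < 0)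
    (hdeg : P.natDegree < R.natDegree) :
    ∃ ε : ℝ, ε ≠ 0 ∧ (∀ k, 0 < (P + C ε * R).eval (u k) * P.eval (u k)) ∧
      N + 1 ≤ ((P + C ε * R).roots.toFinset.filter (fun t => 0 < t)).card := by
  -- a uniform smallness bound `δ ≤ |P(u_k)| / (|R(u_k)| + 1)`
  set δf : Fin (N + 1) → ℝ := fun k => |P.eval (u k)| / (|R.eval (u k)| + 1) with hδf
  have hδf_pos : ∀ k, 0 < δf k := fun k => div_pos (abs_pos.2 (hP0 k)) (by positivity)
  set δ : ℝ := Finset.univ.inf' ⟨0, Finset.mem_univ _⟩ δf with hδ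
  have hδpos : 0 < δ := (Finset.lt_inf'_iff _).2 fun k _ => hδf_pos k
  have hδle : ∀ k, δ ≤ δf k := fun k => Finset.inf'_le δf (Finset.mem_univ k)
  -- the sign of `ε`: opposite to `P(u_N) · lc(R)`
  set c : ℝ := R.leadingCoeff with hc
  have hR0 : R ≠ 0 := by rintro rfl; simp at hdeg
  have hc0 : c ≠ 0 := leadingCoeff_ne_zero.2 hR0
  set a : ℝ := P.eval (u (Fin.last N)) with ha
  have ha0 : a ≠ 0 := hP0 _
  obtain ⟨ε, hεabs, hεsign⟩ : ∃ ε : ℝ, |ε| = δ / 2 ∧ ε * c * a < 0 := by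
    rcases lt_or_gt_of_ne (mul_ne_zero hc0 ha0) with h | h
    · exact ⟨δ / 2, by rw [abs_of_pos (half_pos hδpos)], by nlinarith⟩
    · exact ⟨-(δ / 2), by rw [abs_neg, abs_of_pos (half_pos hδpos)], by nlinarith⟩
  have hε0 : ε ≠ 0 := by
    intro h; rw [h, abs_zero] at hεabs; linarith
  set Q : ℝ[X] := P + C ε * R with hQ
  have hQev : ∀ t, Q.eval t = P.eval t + ε * R.eval t := by intro t; simp [hQ]
  -- (1) at the old points `Q` has the sign of `P`
  have key1 : ∀ k, 0 < Q.eval (u k) * P.eval (u k) := by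
    intro k
    have hPk : 0 < |P.eval (u k)| := abs_pos.2 (hP0 k)
    have hsmall : |ε * R.eval (u k)| < |P.eval (u k)| := by
      rw [abs_mul, hεabs]
      have h1 : δ / 2 * |R.eval (u k)| ≤ δf k / 2 * |R.eval (u k)| :=
        mul_le_mul_of_nonneg_right (by linarith [hδle k]) (abs_nonneg _)
      have h2 : δf k / 2 * |R.eval (u k)| < δf k * (|R.eval (u k)| + 1) := by
        have := hδf_pos k; nlinarith [abs_nonneg (R.eval (u k))]
      have h3 : δf k * (|R.eval (u k)| + 1) = |P.eval (u k)| := by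
        rw [hδf]; field_simp
      linarith
    rw [hQev]
    have := (abs_lt.1 hsmall).1
    have h4 : |ε * R.eval (u k) * P.eval (u k)| < P.eval (u k) * P.eval (u k) := by
      rw [abs_mul (ε * R.eval (u k)), ← abs_mul_self (P.eval (u k)), abs_mul (P.eval (u k))]
      exact mul_lt_mul_of_pos_right hsmall hPk
    have := (abs_lt.1 h4).1
    nlinarith
  -- (2) far to the right `Q` has the sign of `ε·c`
  have hQdeg : Q.natDegree = R.natDegree := by
    rw [hQ, natDegree_add_eq_right_of_natDegree_lt (by rwa [natDegree_C_mul hε0]), natDegree_C_mul hε0]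
  have hQlc : Q.leadingCoeff = ε * c := by
    rw [hQ, leadingCoeff_add_of_degree_lt (degree_lt_degree (by rwa [natDegree_C_mul hε0])), leadingCoeff_mul,
      leadingCoeff_C]
  have hQdeg' : 0 < Q.degree := by
    rw [← natDegree_pos_iff_degree_pos, hQdeg]; omega
  obtain ⟨T, hTgt, hTsign⟩ : ∃ T, u (Fin.last N) < T ∧ 0 < Q.eval T * (ε * c) := by
    rcases lt_or_gt_of_ne (mul_ne_zero hε0 hc0) with hneg | hpos
    · -- `ε c < 0`: `−Q → +∞`
      have hlim : Tendsto (fun x => (-Q).eval x) atTop atTop :=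
        (-Q).tendsto_atTop_of_leadingCoeff_nonneg (by rwa [degree_neg]) (by rw [leadingCoeff_neg, hQlc]; linarith)
      obtain ⟨T, hT1, hT2⟩ := ((hlim.eventually_gt_atTop 0).and (eventually_gt_atTop (u (Fin.last N)))).exists
      refine ⟨T, hT2, ?_⟩
      rw [eval_neg] at hT1
      nlinarith
    · have hlim : Tendsto (fun x => Q.eval x) atTop atTop :=
        Q.tendsto_atTop_of_leadingCoeff_nonneg hQdeg' (by rw [hQlc]; exact hpos.le)
      obtain ⟨T, hT1, hT2⟩ := ((hlim.eventually_gt_atTop 0).and (eventually_gt_atTop (u (Fin.last N)))).exists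
      exact ⟨T, hT2, mul_pos hT1 hpos⟩
  -- (3) count: block `u` with witnesses `P(u_k)`, block `(T)` with witness `ε·c`
  have h := le_card_posRoots_two_blocks (W := 0) Q u (fun _ => T) (fun k => P.eval (u k)) (fun _ => ε * c)
    huM (fun i j hij => absurd hij (by simp [Fin.eq_zero i, Fin.eq_zero j])) hu0 hTgt key1 (fun _ => hTsign) halt
    (fun j => Fin.elim0 j) (by nlinarith [hεsign])
  exact ⟨ε, hε0, key1, by simpa using h⟩

end GraftFloor

end Summit.ValiantsHypothesis.ValiantsHypothesis.Theorems.KPlusLogSqLaw.TowerGraft
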